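import Summits.ValiantsHypothesis.ValiantsHypothesis.Theorems.BarrierLeverPartitionMinorsHitByVPHiddenStatesAddRow
import Summits.ValiantsHypothesis.ValiantsHypothesis.Theorems.BarrierLeverPartitionMinorsHitByVPHiddenStatesSupports

/-!
# Route BarrierLever — item `PartitionMinorsHitByVP` (stmt-ValiantsHypothesis-19717), line `hidden_states`:
# TILING CORE + FREE EXTENSION — «mirror the structured core, let free points absorb the rest»

Helper file (`--supports stmt-ValiantsHypothesis-19717`; cell valiant-natproofs, rung V4, 𝒟-side door (c); prover seat val-np-p6 gen 9).
Definition-free. Closes NO item. Sequel of `…HiddenStatesAddRow` (p601464, the one-step ADD-ROW LEMMA `SymbJoin.symGood_addRow`).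

* `SymbJoin.symGood_extend` — ITERATED ADD-ROW: rows/columns indexed by `Fin (r₀ + k)`; if the first `r₀` form a generically good
  configuration, every later row is contained in no EARLIER row, and every later column carries a state carried by no EARLIER column of
  its piece (a fresh free point), the whole configuration is generically good (`symDet ≠ 0`). So a design good for a lower family `u`
  stays good — after adjoining `k` free points — for EVERY family `u ⊔ {k further sets}` (list the new sets by non-decreasing size).
* `SymbJoin.symGood_of_tiling` — THE MIRROR TABLE: if row `k` is the shifted copy `C_p ∪ σ_p(J)` of the hidden set `J` of column `k`
  (`p` its piece; `C_p` constant coordinates, `σ_p` any relabelling of states by coordinates) and the rows are distinct, the 0/1 table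
  «base ↦ 1_{C_p}, state q ↦ e_{σ_p q}» has hidden-point supports equal to the rows, so `symGood_of_supports_eq_rows` (p592799) gives
  generic goodness. E.g. the full Pascal peel `{B_{t−1}([i])}_{i<h} ⊔ B_t([1])` tiles the complete ball `B_t([h])` (row `{i} ∪ J`).
* `SymbJoin.symGood_of_tiling_extend`, `exists_table_of_tiling_extend` — both together, ending in the `∃ tx, det ≠ 0` form of the
  line's stubs: a design whose structured pieces TILE a core `u₀ ⊆ u` and whose remaining columns are free points is good for `u`
  whenever the rows of `u ∖ u₀` can be listed so that none is contained in an earlier row (always possible when `u₀` is a lower set: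
  non-decreasing size).

Ball-game reading (memo HOME/val-np-p6/g8/MEMO-cuttree-valnp6-g8.md §5, census HOME/val-np-p6/g9): universality of a position is monotone
in the number of free points, and «design = peel ⊔ F free points» beats «ball ⊔ ANY F extra sets» for every h — the first all-h class of
the line whose adversary part is completely arbitrary.

WHAT THIS IS NOT: nothing about which structured cores tile which families beyond the hypothesis `hrow`; item 19717 OPEN; nothing on
crux 14610 or VP ≠ VNP.
-/

set_option linter.dupNamespace false

namespace Summit.ValiantsHypothesis.ValiantsHypothesis.Theorems.BarrierLever.HiddenStates

open Finset Matrix MvPolynomial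

noncomputable section

namespace SymbJoin

variable {h m K r : ℕ}

/-! ## 1. Iteration: extending a good configuration by several maximal rows and private columns -/

/-- `Fin.castAdd (k+1) i = Fin.castSucc (Fin.castAdd k i)`. -/
theorem castAdd_succ_eq {r₀ k : ℕ} (i : Fin r₀) :
    (Fin.castAdd (k + 1) i : Fin (r₀ + (k + 1))) = Fin.castSucc (Fin.castAdd k i) :=
  Fin.ext rfl

/-- **EXTENSION THEOREM (free points absorb arbitrary rows).** Rows/columns are indexed by `Fin (r₀ + k)`: the first `r₀` (via
`Fin.castAdd k`) form a generically good configuration; every later row is contained in no EARLIER row; every later column carries a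
state that no EARLIER column of the same piece carries (a fresh free point). Then the whole configuration is generically good.
Typical use: `u = (lower family served by a structured design) ⊔ (any further sets, listed by non-decreasing size)`,
`e = (structured design) ⊔ (points of star pieces)`. -/
theorem symGood_extend (r₀ : ℕ) : ∀ (k : ℕ) (u : Fin (r₀ + k) → Finset (Fin h)) (e : Fin (r₀ + k) → Fin m × Finset (Fin K)),
    symDet (fun i : Fin r₀ => u (Fin.castAdd k i)) (fun i => e (Fin.castAdd k i)) ≠ 0 →
    (∀ i j : Fin (r₀ + k), r₀ ≤ (j : ℕ) → i < j → ¬ u j ⊆ u i) →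
    (∀ j : Fin (r₀ + k), r₀ ≤ (j : ℕ) → ∃ q ∈ (e j).2, ∀ i : Fin (r₀ + k), i < j → (e i).1 = (e j).1 → q ∉ (e i).2) →
    symDet u e ≠ 0
  | 0, u, e, h0, _, _ => by
    have hu : (fun i : Fin r₀ => u (Fin.castAdd 0 i)) = u := funext fun i => congrArg u (Fin.ext rfl)
    have he : (fun i : Fin r₀ => e (Fin.castAdd 0 i)) = e := funext fun i => congrArg e (Fin.ext rfl)
    rwa [hu, he] at h0
  | k + 1, u, e, h0, hmax, hpriv => by
    classical
    -- peel off the last row and the last column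
    have hlast : r₀ ≤ ((Fin.last (r₀ + k) : Fin (r₀ + (k + 1))) : ℕ) := by simp
    obtain ⟨q, hq, hqpriv⟩ := hpriv (Fin.last (r₀ + k)) hlast
    refine symGood_addRow_private (r₀ := r₀ + k) u e (Fin.last (r₀ + k)) (Fin.last (r₀ + k)) q hq ?_ ?_ ?_
    · intro j hj
      rw [Fin.succAbove_last] at hj ⊢
      exact hqpriv _ (Fin.castSucc_lt_last j) hj
    · intro j
      rw [Fin.succAbove_last]
      exact hmax _ _ hlast (Fin.castSucc_lt_last j)
    · -- the induction hypothesis for the first r₀ + k rows/columns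
      have IH := symGood_extend r₀ k (fun i => u (Fin.castSucc i)) (fun i => e (Fin.castSucc i)) ?_ ?_ ?_
      · simpa only [Fin.succAbove_last] using IH
      · have hu : (fun i : Fin r₀ => u (Fin.castSucc (Fin.castAdd k i))) = fun i => u (Fin.castAdd (k + 1) i) :=
          funext fun i => congrArg u (castAdd_succ_eq i).symm
        have he : (fun i : Fin r₀ => e (Fin.castSucc (Fin.castAdd k i))) = fun i => e (Fin.castAdd (k + 1) i) :=
          funext fun i => congrArg e (castAdd_succ_eq i).symm
        rw [hu, he]
        exact h0
      · intro i j hj hij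
        exact hmax (Fin.castSucc i) (Fin.castSucc j) (by simpa using hj) (by simpa using hij)
      · intro j hj
        obtain ⟨q', hq', H⟩ := hpriv (Fin.castSucc j) (by simpa using hj)
        exact ⟨q', hq', fun i hij hp => H (Fin.castSucc i) (by simpa using hij) hp⟩

/-! ## 2. The tiling (mirror) table: rows that are shifted copies of the hidden sets -/

/-- **TILING THEOREM (the mirror strategy as one table).** Suppose each piece `p` is given a set of CONSTANT coordinates `C p` and a
relabelling of its states by coordinates `σ p : Fin K → Fin h` (not necessarily injective or disjoint from `C p`), and row `k` is exactly the shifted copy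
`C p ∪ σ p (J)` of the hidden set of column `k` (`(p, J) = e k`), the rows being pairwise distinct. Then the configuration is generically
good: the 0/1 table «base of piece `p` = indicator of `C p`, state `q` of piece `p` = unit vector of `σ p q`» puts the hidden point of
column `k` at a vector with support `u k`, and `symGood_of_supports_eq_rows` (p592799) applies. This is the kernel form of the MIRROR
strategy of the cut-tree game (a design that TILES the row family by shifted copies of its pieces wins without a single cut decision),
e.g. the full Pascal peel `{B_{t-1}([i]) : i < h} ⊔ B_t([1])` against the complete ball `B_t([h])` (row `{i} ∪ J` for the member `J` of
the `i`-th piece). -/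
theorem symGood_of_tiling (u : Fin r → Finset (Fin h)) (hu : Function.Injective u) (e : Fin r → Fin m × Finset (Fin K))
    (Cst : Fin m → Finset (Fin h)) (σ : Fin m → Fin K → Fin h)
    (hrow : ∀ k a, a ∈ u k ↔ a ∈ Cst (e k).1 ∨ ∃ q ∈ (e k).2, σ (e k).1 q = a) : symDet u e ≠ 0 := by
  classical
  let tx : Fin m → Option (Fin K) → Fin h → ℂ := fun p o a =>
    match o with
    | none => if a ∈ Cst p then 1 else 0
    | some q => if σ p q = a then 1 else 0
  refine symGood_of_supports_eq_rows u hu e tx fun k a => ?_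
  have hval : tx (e k).1 none a + ∑ q ∈ (e k).2, tx (e k).1 (some q) a
      = (((if a ∈ Cst (e k).1 then 1 else 0) + ((e k).2.filter fun q => σ (e k).1 q = a).card : ℕ) : ℂ) := by
    simp only [tx, Nat.cast_add, Nat.cast_ite, Nat.cast_one, Nat.cast_zero, Finset.card_filter, Nat.cast_sum]
  rw [hval, Nat.cast_ne_zero, hrow]
  constructor
  · intro hne
    by_cases hc : a ∈ Cst (e k).1
    · exact Or.inl hc
    · right
      rw [if_neg hc, zero_add] at hne
      obtain ⟨q, hq⟩ := Finset.card_pos.mp (Nat.pos_of_ne_zero hne)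
      rw [Finset.mem_filter] at hq
      exact ⟨q, hq.1, hq.2⟩
  · rintro (hc | ⟨q, hq, hqa⟩)
    · rw [if_pos hc]; omega
    · have : 0 < ((e k).2.filter fun q => σ (e k).1 q = a).card :=
        Finset.card_pos.mpr ⟨q, Finset.mem_filter.mpr ⟨hq, hqa⟩⟩
      omega

/-- **Tiling core + free extension.** The first `r₀` columns tile the first `r₀` rows (as in `symGood_of_tiling`), every later row is
contained in no earlier row, every later column carries a state private among the earlier columns of its piece: generically good. In the
language of the ball game: «mirror the structured core, let free points absorb the rest». -/
theorem symGood_of_tiling_extend (r₀ k : ℕ) (u : Fin (r₀ + k) → Finset (Fin h)) (e : Fin (r₀ + k) → Fin m × Finset (Fin K))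
    (hu : Function.Injective fun i : Fin r₀ => u (Fin.castAdd k i))
    (Cst : Fin m → Finset (Fin h)) (σ : Fin m → Fin K → Fin h)
    (hrow : ∀ (i : Fin r₀) a, a ∈ u (Fin.castAdd k i) ↔
      a ∈ Cst (e (Fin.castAdd k i)).1 ∨ ∃ q ∈ (e (Fin.castAdd k i)).2, σ (e (Fin.castAdd k i)).1 q = a)
    (hmax : ∀ i j : Fin (r₀ + k), r₀ ≤ (j : ℕ) → i < j → ¬ u j ⊆ u i)
    (hpriv : ∀ j : Fin (r₀ + k), r₀ ≤ (j : ℕ) → ∃ q ∈ (e j).2, ∀ i : Fin (r₀ + k), i < j → (e i).1 = (e j).1 → q ∉ (e i).2) :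
    symDet u e ≠ 0 :=
  symGood_extend r₀ k u e
    (symGood_of_tiling (fun i : Fin r₀ => u (Fin.castAdd k i)) hu (fun i => e (Fin.castAdd k i)) Cst σ fun i a => hrow i a)
    hmax hpriv

/-- The numeric form used by the line's stubs (`∃ tx, det ≠ 0`). -/
theorem exists_table_of_tiling_extend (r₀ k : ℕ) (u : Fin (r₀ + k) → Finset (Fin h)) (e : Fin (r₀ + k) → Fin m × Finset (Fin K))
    (hu : Function.Injective fun i : Fin r₀ => u (Fin.castAdd k i))
    (Cst : Fin m → Finset (Fin h)) (σ : Fin m → Fin K → Fin h)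
    (hrow : ∀ (i : Fin r₀) a, a ∈ u (Fin.castAdd k i) ↔
      a ∈ Cst (e (Fin.castAdd k i)).1 ∨ ∃ q ∈ (e (Fin.castAdd k i)).2, σ (e (Fin.castAdd k i)).1 q = a)
    (hmax : ∀ i j : Fin (r₀ + k), r₀ ≤ (j : ℕ) → i < j → ¬ u j ⊆ u i)
    (hpriv : ∀ j : Fin (r₀ + k), r₀ ≤ (j : ℕ) → ∃ q ∈ (e j).2, ∀ i : Fin (r₀ + k), i < j → (e i).1 = (e j).1 → q ∉ (e i).2) :
    ∃ tx : Fin m → Option (Fin K) → Fin h → ℂ,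
      (Matrix.of fun i k' : Fin (r₀ + k) =>
        ∏ a ∈ u i, (tx (e k').1 none a + ∑ q ∈ (e k').2, tx (e k').1 (some q) a)).det ≠ 0 :=
  exists_table_of_symGood u e (symGood_of_tiling_extend r₀ k u e hu Cst σ hrow hmax hpriv)

end SymbJoin

end

end Summit.ValiantsHypothesis.ValiantsHypothesis.Theorems.BarrierLever.HiddenStates
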